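/-
Copyright: lit-balaban cell, Phase-2 proof seat p33 (gen 10).  Statement-level skeleton of a published paper; no proof claims beyond
what the kernel checks below.
-/
import Literature.MathematicalPhysics.QuantumFieldTheory.BalabanImbrieJaffe1984to88.BIJ85TorusReflections
import Literature.MathematicalPhysics.QuantumFieldTheory.BalabanImbrieJaffe1984to88.BIJ88Sect2TranslInvTorus
import Literature.MathematicalPhysics.QuantumFieldTheory.BalabanImbrieJaffe1984to88.BIJ88Eq541Base0

/-!
# `BalabanImbrieJaffe1984to88.BIJ85TkCovariance` — T. Bałaban, J. Imbrie, A. Jaffe, *Renormalization of the Higgs model: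
minimizers, propagators and the stability of mean field theory*, Commun. Math. Phys. **97** (1985) 299–329 [BalabanImbrieJaffe1985]:
**the operators of record `H_{j,Ax}` (4.1.3), `C^{(j)}` (4.3.3), `H_j` (4.4.2), `𝒟_k` (4.4.4), `Q^{e*}_k` (2.24) and
`T_k = 𝒟_k∂^*Q^{e*}_k` (the correction of the second form of (7.3.2), [BalabanImbrieJaffe1988] (5.4.1)) COMMUTE WITH THE CENTRE
REFLECTIONS `x_ρ ↦ −x_ρ − 1` of the nested tori** (file 2/3 of the gen-10 member of SKELETON row **C1.Eq7.3.1-7.3.2** — the k-UNIFORM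
line-sum constant of the second printed form of (7.3.2) by reflection symmetry, GAPS G-C1-05 ADDENDA 7–8 item (γ′); file 1 =
`BIJ85TorusReflections`), together with the translation covariance of `T_k` assembled from r18's `BIJ88Sect2TranslInvTorus`.

statement-level skeleton of published theorems with citation tags; proofs where landed; nothing here is a claim about the Yang–Mills mass gap

THE PRINTED TEXT whose symmetry is proved.  p. 321 [PDF 23], Thm. 7.1.1: *"Since we study periodic boundary conditions, σ_k is
translation invariant."*; [BalabanImbrieJaffe1988] p. 260: *"H_k is also translation invariant"*; the operators are those of (4.1.3)
p. 310 (`H_{k,Ax}`, *"the axial gauge minimizer"*), (4.3.3) p. 311 (`C^{(k)}`), (4.4.2) p. 312 (`H_kB = Z_k(B)⁻¹∫…`), (4.4.4) p. 312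
(*"𝒟_k = Σ_{j=0}^{k−1} H_jC^{(j)}H_j*"*) and p. 326 [PDF 28] (*"The second form of the inequality substitutes v_b for u_k(b)"*, whose
correction operator is `T_k = 𝒟_k∂^*Q^{e*}_k`, p11's `BIJ88Eq541Base0.TkF`).  The reflections through the block boundaries
`{x_ρ = −½}` are symmetries of every one of these data on the torus (periodic boundary conditions AND the centred block geometry of
`Setup`), exactly as the unit-lattice translations are; the paper uses the Euclidean covariance of its operators tacitly throughout
(e.g. p. 325, the kernels depend on `|x − y|`).

WHAT THIS FILE PROVES (0 `sorry`; no `def … : Prop`; nothing of the tree re-declared; standing range `j ≤ m + K`, `c ≠ 0`, `w > 0`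
where the minimizers are involved).
* §0 `signedPerm` — a signed coordinate permutation `f ↦ (ε_i f(σ i))_i` (`σ` an involution, `ε = ±1` `σ`-invariant) as a linear
  ISOMETRY of `EuclideanSpace ℝ ι`; §1 its four instances: the reflections `vecReflE ρ j` of `ℓ²`-bond vectors of `T^{(j)}` (file 1's
  `reflV`, sign `−1` on `ρ`-bonds), `siteReflE ρ` of gauge functions (`reflS`), `plaqReflE ρ j` of plaquette vectors (`reflP`, sign
  `−1` on plaquettes containing `ρ`) — the `U_E`, `U_Λ`, `U_F`, `U_B` of p27's `sigmaOp_equivariant` / r16's `Hop_equivariant`.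
* §2 the intertwinings: `∂` (`curlOp_vecReflE`), the V1 Landau operators `∂`, `∂*`, `(∂*)†`, `Q_k`, `Q′_k` of p11's `opsV1`
  (`N(Q′_k)` invariant), the support `δ(Q_kA)δ_{k,Ax}(A)` (`vecReflE_mem_V411_iff`), the one-step constraint space `δ(QB)δ_{Ax}(B)`
  (`vecReflE_mem_Wstep_iff`), `Q^{e*}_k` (`QesOp_plaqReflE`), and **`Q^{s*}_j` modulo the constraint space**: `c_ρ(Q^{s*}_jB) −
  Q^{s*}_j(c_ρB) ∈ δ(Q_jA)δ_{j,Ax}(A)` (`vecReflE_QsE_sub_mem` — the surface pull-back itself is NOT reflection covariant bond by bond,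
  only its class is, which is all the minimizer sees).
* §3 **the minimizers commute with the reflections**: `minimizer_equivariant` (abstract: the constrained minimizer (4.1.3) of a
  symmetric problem is equivariant), `HaxE_vecReflE` (`H_{j,Ax}(c_ρB) = c_ρ(H_{j,Ax}B)`, by `minimizer_congr` — the minimizer depends
  only on the class), `CE_vecReflE` (`C^{(j)}`, p27's `axialPropagator_equivariant` with r18's `noZeroModes_Wstep`), `HkE_vecReflE`
  (`H_j`, r16's `Hop_equivariant` through p30's `Hop_torus_eq_HkE`), `DkE_vecReflE` (`𝒟_k`, term by term), and **`TkF_reflP`**: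
  `T_k(c_ρg) = c_ρ(T_kg)` for p11's `TkF` on plain functions.
* §4 the translation partner **`TkF_translP`**: `T_k(τ_tg) = τ_{L^kt}(T_kg)`, `t ∈ T^{(k)}`, assembled from r18's `DkE_translate`,
  g3's `QesOp_unitPlaqTransl`, `curlOp_bondTransl`.
HONEST SCOPE.  Operator identities on the tori of `Setup` only; nothing analytic; coordinate permutations not treated; the reflections
are those through the block boundaries `{x_ρ = −½}` (a reflection through the boundary of a general k-block is one of these followed
by a unit-lattice translation of `T^{(k)}`, both covariances being proved here).  The use (file 3): for a field `g` odd under the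
reflection exchanging the two rows adjacent to a unit bond, the line sums of `T_kg` over the two rows are opposite.

CITATION HEADER (lean-in-tree rule).  Phase-2 file of the lit-balaban TYPED SKELETON (HOME `run/shared/lean/pub/lit-balaban/`), seat
p33 gen 10 (unit `lit-balaban-p33-g10`; TAKING line HOME/STATUS.md 2026-08-22T03:08Z; owner r15, referee ref-5).
-/

open scoped BigOperators RealInnerProductSpace

namespace Literature.MathematicalPhysics.QuantumFieldTheory.BalabanImbrieJaffe1984to88.BIJ85TkCovariance

open Literature.MathematicalPhysics.QuantumFieldTheory.Balaban1983to89 hiding Site Plaq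
open Balaban1983to89.LatticeFieldCalculus
open BIJ85AxialPropagator411 (BondSpace PlaqSpace toE curlOp V411 mem_V411 axialPropagator deltaAx)
open BIJ85AxialMinimizer413 (minimizer minimizer_congr)
open BIJ85Prop521Proof (HaxOp HaxOp_eq_minimizer)
open BIJ85Prop521Torus (CoarseSpace toEj QcE QsE Wstep mem_Wstep QcE_apply QsE_apply)
open BIJ85Prop522Torus (HaxE CE HkE DkE hD_V411)
open BIJ85Sigma421Torus (UnitPlaqSpace toU toP QesOp QesOp_apply)
open BIJ85Sigma422Equivariance (adjoint_intertwine axialPropagator_equivariant)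
open BIJ85SigmaTranslationInvariance (translV translP bondTransl plaqTransl unitPlaqTransl bondTransl_apply plaqTransl_apply
  unitPlaqTransl_apply toE_symm_bondTransl curlOp_bondTransl QesOp_unitPlaqTransl)
open BIJ85Eq531Inputs (QsstarIter QestarIter bondAvgIter_QsstarIter deltaAx_QsstarIter sub_QsstarIter_mem_constraint411)
open BIJ85LandauForm441 (LandauOps)
open BIJ85LandauMinimizer442V1 (opsV1 opsV1_curl opsV1_dstar opsV1_Qp)
open BIJ85TorusReflections
open BIJ88Eq541Base0 (TkF TkF_apply)
open BIJ88Sect2TranslInvTorus (noZeroModes_Wstep DkE_translate)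
open BalabanJaffe1986.BJ86TranslInv246Torus (Hop_equivariant)
open BalabanJaffe1986.BJ86FeynmanMinimizer233Torus (Hop_torus_eq_HkE)
open Balaban1983to89 renaming Site → TSite, Plaq → TPlaq

noncomputable section

variable {P : Params}

/-! ## §0  Signed coordinate permutations of `ℓ²(ι)` as linear isometries -/

section SignedPerm

variable {ι : Type*} [Fintype ι]

/-- **A signed coordinate permutation** `f ↦ (ε_i·f(σ i))_i` of `EuclideanSpace ℝ ι`, for an INVOLUTION `σ` and a `σ`-invariant
sign `ε = ±1`, as a linear isometric isomorphism (its own inverse) — the shape of every lattice reflection acting on bond /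
site / plaquette vectors. [folklore] -/
def signedPerm (σ : ι → ι) (ε : ι → ℝ) (hσ : Function.Involutive σ) (hεσ : ∀ i, ε (σ i) = ε i)
    (hε : ∀ i, ε i * ε i = 1) : EuclideanSpace ℝ ι ≃ₗᵢ[ℝ] EuclideanSpace ℝ ι where
  toFun f := WithLp.toLp 2 (fun i => ε i * f (σ i))
  invFun f := WithLp.toLp 2 (fun i => ε i * f (σ i))
  map_add' f g := by ext i; simp [mul_add]
  map_smul' a f := by ext i; simp [mul_left_comm]
  left_inv f := by ext i; simp [hσ i, hεσ, ← mul_assoc, hε]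
  right_inv f := by ext i; simp [hσ i, hεσ, ← mul_assoc, hε]
  norm_map' f := by
    rw [EuclideanSpace.norm_eq, EuclideanSpace.norm_eq]
    congr 1
    calc ∑ i, ‖(WithLp.toLp 2 (fun i => ε i * f (σ i)) : EuclideanSpace ℝ ι) i‖ ^ 2 = ∑ i, ‖f (σ i)‖ ^ 2 := by
          refine Finset.sum_congr rfl fun i _ => ?_
          have h1 : ‖ε i‖ ^ 2 = 1 := by rw [Real.norm_eq_abs, sq_abs, sq, hε]
          rw [PiLp.toLp_apply, norm_mul, mul_pow, h1, one_mul]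
      _ = ∑ i, ‖f i‖ ^ 2 := hσ.bijective.sum_comp (fun i => ‖f i‖ ^ 2)

/-- `signedPerm` evaluated. [folklore] -/
@[simp] private theorem signedPerm_apply (σ : ι → ι) (ε : ι → ℝ) (hσ : Function.Involutive σ) (hεσ : ∀ i, ε (σ i) = ε i)
    (hε : ∀ i, ε i * ε i = 1) (f : EuclideanSpace ℝ ι) (i : ι) : signedPerm σ ε hσ hεσ hε f i = ε i * f (σ i) := rfl

end SignedPerm

/-! ## §1  The reflections of bond, site and plaquette vectors as isometries -/

/-- kernel: the bond sign `ε_b = −1` on `ρ`-bonds, `+1` otherwise. [cite: BalabanImbrieJaffe1985, (2.5) p.302] -/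
def bsign (ρ : Fin P.d) {j : ℕ} (b : PBond P j) : ℝ := if b.dir = ρ then -1 else 1

/-- kernel: the plaquette sign `ε_p = −1` on plaquettes containing the direction `ρ`, `+1` otherwise. [cite: BalabanImbrieJaffe1985, (2.20) p.305] -/
def psign (ρ : Fin P.d) {j : ℕ} (p : TPlaq P j) : ℝ := if p.μ = ρ ∨ p.ν = ρ then -1 else 1

/-- **The reflection `c_ρ` of `ℓ²`-bond vectors of `T^{(j)}`** (file 1's `reflV` transported: `(c_ρA)(b) = ε_b·A(breflect ρ b)`),
a linear isometry of p30's `CoarseSpace P j` (`j = 0`: p09's `BondSpace P`) — the `U_E` / `U_B`. [cite: BalabanImbrieJaffe1985, (2.5) p.302] -/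
def vecReflE (ρ : Fin P.d) (j : ℕ) : CoarseSpace P j ≃ₗᵢ[ℝ] CoarseSpace P j :=
  signedPerm (breflect ρ) (bsign ρ) (breflect_breflect ρ) (fun _ => rfl) (fun b => by
    unfold bsign; split_ifs <;> norm_num)

/-- **The reflection of gauge functions** (`(c_ρλ)(x) = λ(c_ρx)`, file 1's `reflS`) as a linear isometry of `ℓ²(T^{(0)})` — the `U_Λ`.
[cite: BalabanImbrieJaffe1985, (2.7) p.303] -/
def siteReflE (ρ : Fin P.d) : EuclideanSpace ℝ (TSite P 0) ≃ₗᵢ[ℝ] EuclideanSpace ℝ (TSite P 0) :=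
  signedPerm (crefl ρ) (fun _ => 1) (crefl_crefl ρ) (fun _ => rfl) (fun _ => one_mul 1)

/-- **The reflection of plaquette vectors of `T^{(j)}`** (file 1's `reflP`: `(c_ρg)(p) = ε_p·g(preflect ρ p)`), a linear isometry of
p30's `UnitPlaqSpace P j` (`j = 0`: p09's `PlaqSpace P`) — the `U_F` / `U_{F′}`. [cite: BalabanImbrieJaffe1985, (2.20) p.305] -/
def plaqReflE (ρ : Fin P.d) (j : ℕ) : UnitPlaqSpace P j ≃ₗᵢ[ℝ] UnitPlaqSpace P j :=
  signedPerm (preflect ρ) (psign ρ) (preflect_preflect ρ) (fun _ => rfl) (fun p => by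
    unfold psign; split_ifs <;> norm_num)

/-- `vecReflE` IS `reflV` on components. [cite: BalabanImbrieJaffe1985, (2.5) p.302] -/
theorem vecReflE_apply (ρ : Fin P.d) {j : ℕ} (A : CoarseSpace P j) (b : PBond P j) :
    vecReflE ρ j A b = reflV ρ (WithLp.ofLp A) b := by
  simp only [vecReflE, signedPerm_apply, reflV_apply, bsign]
  split_ifs <;> simp

/-- `vecReflE` IS `reflV`: `ofLp (c_ρA) = reflV ρ (ofLp A)`. [cite: BalabanImbrieJaffe1985, (2.5) p.302] -/
theorem ofLp_vecReflE (ρ : Fin P.d) {j : ℕ} (A : CoarseSpace P j) : WithLp.ofLp (vecReflE ρ j A) = reflV ρ (WithLp.ofLp A) :=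
  funext (vecReflE_apply ρ A)

/-- … under p09's identification `toE` (level 0). [cite: BalabanImbrieJaffe1985, (2.5) p.302] -/
theorem toE_symm_vecReflE (ρ : Fin P.d) (A : BondSpace P) : (toE P).symm (vecReflE ρ 0 A) = reflV ρ ((toE P).symm A) :=
  ofLp_vecReflE ρ A

/-- … under p30's identification `toEj` (level j). [cite: BalabanImbrieJaffe1985, (2.5) p.302] -/
theorem toEj_symm_vecReflE (ρ : Fin P.d) {j : ℕ} (B : CoarseSpace P j) :
    (toEj P j).symm (vecReflE ρ j B) = reflV ρ ((toEj P j).symm B) :=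
  ofLp_vecReflE ρ B

/-- `toE (reflV ρ A) = c_ρ(toE A)`. [cite: BalabanImbrieJaffe1985, (2.5) p.302] -/
theorem toE_reflV (ρ : Fin P.d) (A : VecField P 0 ℝ) : toE P (reflV ρ A) = vecReflE ρ 0 (toE P A) := by
  apply (toE P).symm.injective
  rw [LinearEquiv.symm_apply_apply, toE_symm_vecReflE, LinearEquiv.symm_apply_apply]

/-- `toEj (reflV ρ B) = c_ρ(toEj B)`. [cite: BalabanImbrieJaffe1985, (2.5) p.302] -/
theorem toEj_reflV (ρ : Fin P.d) {j : ℕ} (B : VecField P j ℝ) : toEj P j (reflV ρ B) = vecReflE ρ j (toEj P j B) := by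
  apply (toEj P j).symm.injective
  rw [LinearEquiv.symm_apply_apply, toEj_symm_vecReflE, LinearEquiv.symm_apply_apply]

/-- `siteReflE` IS `reflS` on components. [cite: BalabanImbrieJaffe1985, (2.7) p.303] -/
theorem siteReflE_apply (ρ : Fin P.d) (f : EuclideanSpace ℝ (TSite P 0)) (x : TSite P 0) :
    siteReflE ρ f x = reflS ρ (WithLp.ofLp f) x := by
  simp only [siteReflE, signedPerm_apply, reflS_apply, one_mul]

/-- `ofLp (c_ρλ) = reflS ρ (ofLp λ)`. [cite: BalabanImbrieJaffe1985, (2.7) p.303] -/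
theorem ofLp_siteReflE (ρ : Fin P.d) (f : EuclideanSpace ℝ (TSite P 0)) : WithLp.ofLp (siteReflE ρ f) = reflS ρ (WithLp.ofLp f) :=
  funext (siteReflE_apply ρ f)

/-- `plaqReflE` IS `reflP` on components. [cite: BalabanImbrieJaffe1985, (2.20) p.305] -/
theorem plaqReflE_apply (ρ : Fin P.d) {j : ℕ} (g : UnitPlaqSpace P j) (p : TPlaq P j) :
    plaqReflE ρ j g p = reflP ρ (fun q => g q) p := by
  simp only [plaqReflE, signedPerm_apply, reflP_apply, psign]
  split_ifs <;> simp

/-- `toU (reflP ρ g) = c_ρ(toU g)` (p30's identification of unit-lattice plaquette fields). [cite: BalabanImbrieJaffe1985, (2.20) p.305] -/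
theorem toU_reflP (ρ : Fin P.d) {j : ℕ} (g : TPlaq P j → ℝ) : toU P j (reflP ρ g) = plaqReflE ρ j (toU P j g) := by
  ext p
  rw [plaqReflE_apply]
  rfl

/-! ## §2  The intertwinings -/

/-- Components of p09's weighted curl (its `curlOp_apply` is private). [folklore] -/
private theorem curlOp_apply' (w c : ℝ) (v : BondSpace P) (p : TPlaq P 0) :
    curlOp (P := P) w c v p = Real.sqrt w * curl c ((toE P).symm v) p := rfl

/-- **`∂` intertwines the reflections**: `∂(c_ρA) = c_ρ(∂A)` for p09's `curlOp w c = √w·∂` (file 1's `curl_reflV`).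
[cite: BalabanImbrieJaffe1985, (4.1.1) p.309] -/
theorem curlOp_vecReflE (w c : ℝ) (ρ : Fin P.d) (A : BondSpace P) :
    curlOp (P := P) w c (vecReflE ρ 0 A) = plaqReflE ρ 0 (curlOp (P := P) w c A) := by
  ext p
  rw [plaqReflE_apply, curlOp_apply', toE_symm_vecReflE, curl_reflV, reflP_apply, reflP_apply]
  split_ifs <;> simp

/-- **`∂^* = ∂†` intertwines the reflections**: `∂^*(c_ρF) = c_ρ(∂^*F)` (adjoints of intertwined maps, p27's `adjoint_intertwine`).
[cite: BalabanImbrieJaffe1985, (4.1.3) p.310] -/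
theorem adjoint_curlOp_plaqReflE (w c : ℝ) (ρ : Fin P.d) (F : PlaqSpace P) :
    LinearMap.adjoint (curlOp (P := P) w c) (plaqReflE ρ 0 F) = vecReflE ρ 0 (LinearMap.adjoint (curlOp (P := P) w c) F) :=
  adjoint_intertwine _ _ _ (curlOp_vecReflE w c ρ) F

/-- **`∂ = s·curl_c` of p11's V1 Landau operators intertwines the reflections.** [cite: BalabanImbrieJaffe1985, (4.4.1) p.311] -/
theorem opsV1_curl_vecReflE (k : ℕ) (c s : ℝ) (ρ : Fin P.d) (A : BondSpace P) :
    (opsV1 P k c s).curl (vecReflE ρ 0 A) = plaqReflE ρ 0 ((opsV1 P k c s).curl A) := by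
  ext p
  have h : WithLp.ofLp (vecReflE ρ 0 A) = reflV ρ (WithLp.ofLp A) := ofLp_vecReflE ρ A
  rw [plaqReflE_apply, opsV1_curl, opsV1_curl, PiLp.smul_apply, PiLp.toLp_apply, h, curl_reflV, reflP_apply, reflP_apply]
  split_ifs <;> simp

/-- **`∂* = s·diverg_c` intertwines the reflections**: `∂*(c_ρA) = c_ρ(∂*A)` (file 1's `diverg_reflV`). [cite: BalabanImbrieJaffe1985, (4.4.1) p.311] -/
theorem opsV1_dstar_vecReflE (k : ℕ) (c s : ℝ) (ρ : Fin P.d) (A : BondSpace P) :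
    (opsV1 P k c s).dstar (vecReflE ρ 0 A) = siteReflE ρ ((opsV1 P k c s).dstar A) := by
  ext x
  have h : WithLp.ofLp (vecReflE ρ 0 A) = reflV ρ (WithLp.ofLp A) := ofLp_vecReflE ρ A
  rw [siteReflE_apply, opsV1_dstar, opsV1_dstar, PiLp.smul_apply, PiLp.toLp_apply, h, diverg_reflV, reflS_apply, reflS_apply]
  simp

/-- **`(∂*)†` (the gauge gradient) intertwines the reflections.** [cite: BalabanImbrieJaffe1985, (4.4.1) p.311] -/
theorem adjoint_dstar_siteReflE (k : ℕ) (c s : ℝ) (ρ : Fin P.d) (l : EuclideanSpace ℝ (TSite P 0)) :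
    LinearMap.adjoint (opsV1 P k c s).dstar (siteReflE ρ l) = vecReflE ρ 0 (LinearMap.adjoint (opsV1 P k c s).dstar l) :=
  adjoint_intertwine _ _ _ (opsV1_dstar_vecReflE k c s ρ) l

/-- **`Q′_k` intertwines the reflections**: `Q′_k(c_ρλ) = c_ρ(Q′_kλ)` (file 1's `siteAvgIter_reflS`; `k ≤ m + K`).
[cite: BalabanImbrieJaffe1985, (2.6) p.303] -/
theorem opsV1_Qp_siteReflE {k : ℕ} (hk : k ≤ P.m + P.K) (c s : ℝ) (ρ : Fin P.d) (l : EuclideanSpace ℝ (TSite P 0)) :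
    (opsV1 P k c s).Qp (siteReflE ρ l) = reflS ρ ((opsV1 P k c s).Qp l) := by
  rw [opsV1_Qp, opsV1_Qp, ofLp_siteReflE, siteAvgIter_reflS ρ k hk]

/-- `reflS` is injective: `c_ρλ = 0 ↔ λ = 0`. [cite: BalabanImbrieJaffe1985, (2.7) p.303] -/
theorem reflS_eq_zero_iff' (ρ : Fin P.d) {j : ℕ} (f : SiteField P j ℝ) : reflS ρ f = 0 ↔ f = 0 := by
  constructor
  · intro h
    have h2 := congrArg (reflS ρ) h
    rw [reflS_reflS] at h2
    rw [h2]
    rfl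
  · rintro rfl
    rfl

/-- **`N(Q′_k)` is carried into itself**: `c_ρλ ∈ N(Q′_k) ↔ λ ∈ N(Q′_k)` (`k ≤ m + K`). [cite: BalabanImbrieJaffe1985, (4.4.1) p.311] -/
theorem siteReflE_mem_kerQp_iff {k : ℕ} (hk : k ≤ P.m + P.K) (c s : ℝ) (ρ : Fin P.d) (l : EuclideanSpace ℝ (TSite P 0)) :
    siteReflE ρ l ∈ (opsV1 P k c s).kerQp ↔ l ∈ (opsV1 P k c s).kerQp := by
  rw [LandauOps.mem_kerQp, LandauOps.mem_kerQp, opsV1_Qp_siteReflE hk, reflS_eq_zero_iff']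

/-- **`Q_k` intertwines the reflections**: `Q_k(c_ρA) = c_ρ(Q_kA)` for p30's Euclidean `QcE` (file 1's `bondAvgIter_reflV`; `k ≤ m + K`).
[cite: BalabanImbrieJaffe1985, (2.23) p.305] -/
theorem QcE_vecReflE {k : ℕ} (hk : k ≤ P.m + P.K) (ρ : Fin P.d) (A : BondSpace P) :
    QcE P k (vecReflE ρ 0 A) = vecReflE ρ k (QcE P k A) := by
  rw [QcE_apply, QcE_apply, toE_symm_vecReflE, bondAvgIter_reflV ρ k hk, toEj_reflV]

/-- **The support `δ(Q_kA)δ_{k,Ax}(A)` of (4.1.1) is reflection invariant**: `c_ρA ∈ V411 P k ↔ A ∈ V411 P k` (file 1's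
`constraint411_reflV_iff` transported; `k ≤ m + K`). [cite: BalabanImbrieJaffe1985, (4.1.1) p.309] -/
theorem vecReflE_mem_V411_iff {k : ℕ} (hk : k ≤ P.m + P.K) (ρ : Fin P.d) (A : BondSpace P) :
    vecReflE ρ 0 A ∈ V411 P k ↔ A ∈ V411 P k := by
  rw [mem_V411, mem_V411, toE_symm_vecReflE, bondAvgIter_reflV ρ k hk, deltaAx_reflV_iff ρ k hk, reflV_eq_zero_iff]

/-- **The one-step constraint space `δ(QB)δ_{Ax}(B)` is reflection invariant**: `c_ρB ∈ Wstep P j ↔ B ∈ Wstep P j` (`Q(c_ρB) = c_ρ(QB)`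
and the centred axial trees go to trees, file 1's `bondAvg_reflV`, `isAxial_reflV_iff`; `j + 1 ≤ m + K`). [cite: BalabanImbrieJaffe1985, (4.3.3) p.311] -/
theorem vecReflE_mem_Wstep_iff {j : ℕ} (hj : j + 1 ≤ P.m + P.K) (ρ : Fin P.d) (B : CoarseSpace P j) :
    vecReflE ρ j B ∈ Wstep P j ↔ B ∈ Wstep P j := by
  rw [mem_Wstep, mem_Wstep, toEj_symm_vecReflE, bondAvg_reflV hj, isAxial_reflV_iff hj, reflV_eq_zero_iff]

/-- **`Q^{s*}_j` modulo the constraint space**: `c_ρ(Q^{s*}_jB) − Q^{s*}_j(c_ρB) ∈ δ(Q_jA)δ_{j,Ax}(A)` — both are axial representatives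
of the class `{Q_jA = c_ρB}` (`Q_jQ^{s*}_j = I`, `δ_{j,Ax}(Q^{s*}_jB)`: p30's `bondAvgIter_QsstarIter`, `deltaAx_QsstarIter`, and the
translation `sub_QsstarIter_mem_constraint411`; `j ≤ m + K`).  (The surface pull-back (2.17) itself is not reflection covariant bond
by bond — its boundary bonds sit at offset `L − 1` — and need not be.) [cite: BalabanImbrieJaffe1985, (5.3.1) p.317] -/
theorem vecReflE_QsE_sub_mem {j : ℕ} (hj : j ≤ P.m + P.K) (ρ : Fin P.d) (B : CoarseSpace P j) :
    vecReflE ρ 0 (QsE P j B) - QsE P j (vecReflE ρ j B) ∈ V411 P j := by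
  have h1 : (toE P).symm (vecReflE ρ 0 (QsE P j B)) = reflV ρ (QsstarIter j ((toEj P j).symm B)) := by
    rw [toE_symm_vecReflE, QsE_apply, LinearEquiv.symm_apply_apply]
  have h2 : (toE P).symm (QsE P j (vecReflE ρ j B)) = QsstarIter j (reflV ρ ((toEj P j).symm B)) := by
    rw [QsE_apply, LinearEquiv.symm_apply_apply, toEj_symm_vecReflE]
  have hQ : bondAvgIter j (reflV ρ (QsstarIter j ((toEj P j).symm B))) = reflV ρ ((toEj P j).symm B) := by
    rw [bondAvgIter_reflV ρ j hj, bondAvgIter_QsstarIter hj]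
  have hAx : deltaAx j (reflV ρ (QsstarIter j ((toEj P j).symm B))) :=
    (deltaAx_reflV_iff ρ j hj _).2 (deltaAx_QsstarIter hj _)
  have h := sub_QsstarIter_mem_constraint411 hj hQ hAx
  rw [V411, Submodule.mem_map]
  refine ⟨_, h, ?_⟩
  rw [LinearEquiv.coe_toLinearMap, map_sub, ← h1, ← h2, LinearEquiv.apply_symm_apply, LinearEquiv.apply_symm_apply]

/-- **`Q^{e*}_k` intertwines the reflections**: `Q^{e*}_k(c_ρf) = c_ρ(Q^{e*}_kf)` for p30's `QesOp = √w·Q^{e*}_k` (file 1's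
`QestarIter_reflP`; `k ≤ m + K`). [cite: BalabanImbrieJaffe1985, (4.2.2) p.310] -/
theorem QesOp_plaqReflE (hd : 2 ≤ P.d) {k : ℕ} (hk : k ≤ P.m + P.K) (w : ℝ) (ρ : Fin P.d) (f : UnitPlaqSpace P k) :
    QesOp (P := P) hd w k (plaqReflE ρ k f) = plaqReflE ρ 0 (QesOp (P := P) hd w k f) := by
  ext p
  rw [plaqReflE_apply, QesOp_apply]
  have h : (fun q => plaqReflE ρ k f q) = reflP ρ (fun q => f q) := funext fun q => plaqReflE_apply ρ f q
  rw [h, QestarIter_reflP hd ρ k hk, reflP_apply, reflP_apply]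
  split_ifs <;> simp [QesOp_apply]

/-! ## §3  The minimizers `H_{j,Ax}`, `C^{(j)}`, `H_j`, the propagator `𝒟_k` and `T_k` commute with the reflections -/

section Minimizer

variable {E F : Type*} [NormedAddCommGroup E] [InnerProductSpace ℝ E] [FiniteDimensional ℝ E]
  [NormedAddCommGroup F] [InnerProductSpace ℝ F] [FiniteDimensional ℝ F]

/-- **The constrained minimizer (4.1.3) of a symmetric problem is equivariant**: for isometries `U_E`, `U_F` with `U_EV = V`,
`∂U_E = U_F∂`, the minimizer of `½‖∂A‖²` over the class `A₀ + V` satisfies `M(U_EA₀) = U_E(M(A₀))` (p09's `minimizer`; by p27's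
`axialPropagator_equivariant` and `adjoint_intertwine`; no zero modes). [cite: BalabanImbrieJaffe1985, (4.1.3) p.310] -/
theorem minimizer_equivariant {V : Submodule ℝ E} {D : E →ₗ[ℝ] F} (hD : ∀ v : V, D (v : E) = 0 → v = 0)
    (UE : E ≃ₗᵢ[ℝ] E) (UF : F ≃ₗᵢ[ℝ] F) (hV : ∀ x ∈ V, UE x ∈ V) (hV' : ∀ x ∈ V, UE.symm x ∈ V)
    (hDU : ∀ x, D (UE x) = UF (D x)) (A₀ : E) :
    minimizer V D (UE A₀) = UE (minimizer V D A₀) := by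
  unfold minimizer
  rw [hDU, adjoint_intertwine D UE UF hDU, axialPropagator_equivariant hD UE UF hV hV' hDU, map_sub]

end Minimizer

/-- **`H_{j,Ax}` commutes with the reflections**: `H_{j,Ax}(c_ρB) = c_ρ(H_{j,Ax}B)` for p11's `HaxE` = p30's `HaxOp V411 ∂ Q^{s*}_j` —
the minimizer of the reflected class is the reflected minimizer (`minimizer_equivariant`), and the class of `Q^{s*}_j(c_ρB)` IS the
reflected class (`vecReflE_QsE_sub_mem`, `minimizer_congr`); `j ≤ m + K`, `c ≠ 0`, `w > 0`. [cite: BalabanImbrieJaffe1985, (4.1.3) p.310] -/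
theorem HaxE_vecReflE {j : ℕ} (hj : j ≤ P.m + P.K) {c : ℝ} (hc : c ≠ 0) {w : ℝ} (hw : 0 < w) (ρ : Fin P.d) (B : CoarseSpace P j) :
    HaxE P w c j (vecReflE ρ j B) = vecReflE ρ 0 (HaxE P w c j B) := by
  have hD := hD_V411 (P := P) hj hc hw
  rw [HaxE, HaxOp_eq_minimizer, HaxOp_eq_minimizer,
    ← minimizer_equivariant hD (vecReflE ρ 0) (plaqReflE ρ 0) (fun x hx => (vecReflE_mem_V411_iff hj ρ x).2 hx)
      (fun x hx => (vecReflE_mem_V411_iff hj ρ _).1 (by rwa [LinearIsometryEquiv.apply_symm_apply])) (curlOp_vecReflE w c ρ)]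
  exact (minimizer_congr hD (vecReflE_QsE_sub_mem hj ρ B)).symm

/-- **`C^{(j)}` commutes with the reflections**: `C^{(j)}(c_ρB) = c_ρ(C^{(j)}B)` for p11's `CE` (the second moment of `½‖∂H_{j,Ax}B‖²`
over `δ(QB)δ_{Ax}(B)`) — p27's `axialPropagator_equivariant` with r18's `noZeroModes_Wstep`, `vecReflE_mem_Wstep_iff` and
`HaxE_vecReflE`; `j + 1 ≤ m + K`, `c ≠ 0`, `w > 0`. [cite: BalabanImbrieJaffe1985, (4.3.3) p.311] -/
theorem CE_vecReflE {j : ℕ} (hj : j + 1 ≤ P.m + P.K) {c : ℝ} (hc : c ≠ 0) {w : ℝ} (hw : 0 < w) (ρ : Fin P.d)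
    (B : CoarseSpace P j) : CE P w c j (vecReflE ρ j B) = vecReflE ρ j (CE P w c j B) :=
  axialPropagator_equivariant (V := Wstep P j) (D := curlOp (P := P) w c ∘ₗ HaxE P w c j) (noZeroModes_Wstep hj hc hw)
    (vecReflE ρ j) (plaqReflE ρ 0) (fun x hx => (vecReflE_mem_Wstep_iff hj ρ x).2 hx)
    (fun x hx => (vecReflE_mem_Wstep_iff hj ρ _).1 (by rwa [LinearIsometryEquiv.apply_symm_apply]))
    (fun x => by rw [LinearMap.comp_apply, LinearMap.comp_apply, HaxE_vecReflE (by omega) hc hw, curlOp_vecReflE]) B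

/-- **`H_j` (4.4.2) commutes with the reflections**: `H_j(c_ρB) = c_ρ(H_jB)` for p11's Landau minimizer `HkE` — r16's
`Hop_equivariant` (every symmetry of the data `(∂*)†, ∂, N(Q′_j), Q_j` commutes with `G_jQ_j^*(Q_jG_jQ_j^*)⁻¹`) through p30's
`Hop_torus_eq_HkE`; `j ≤ m + K`, `c ≠ 0`, `w > 0`. [cite: BalabanImbrieJaffe1985, (4.4.2) p.312] -/
theorem HkE_vecReflE {j : ℕ} (hj : j ≤ P.m + P.K) {c : ℝ} (hc : c ≠ 0) {w : ℝ} (hw : 0 < w) (ρ : Fin P.d) (B : CoarseSpace P j) :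
    HkE P w c j (vecReflE ρ j B) = vecReflE ρ 0 (HkE P w c j B) := by
  rw [← Hop_torus_eq_HkE hj hc hw one_pos]
  exact Hop_equivariant (UF := plaqReflE ρ 0) (adjoint_dstar_siteReflE j c _ ρ) (opsV1_curl_vecReflE j c _ ρ) (QcE_vecReflE hj ρ)
    (fun l hl => (siteReflE_mem_kerQp_iff hj c _ ρ l).2 hl)
    (fun l hl => (siteReflE_mem_kerQp_iff hj c _ ρ _).1 (by rwa [LinearIsometryEquiv.apply_symm_apply])) 1 B

/-- `𝒟_{k+1} = 𝒟_k + H_kC^{(k)}H_k*` for p11's operator sum (4.4.4). [cite: BalabanImbrieJaffe1985, (4.4.4) p.312] -/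
private theorem DkE_succ (w c : ℝ) (k : ℕ) :
    DkE P w c (k + 1) = DkE P w c k + HkE P w c k ∘ₗ CE P w c k ∘ₗ LinearMap.adjoint (HkE P w c k) := by
  simp only [DkE, Finset.sum_range_succ]

/-- **`𝒟_k = Σ_{j<k} H_jC^{(j)}H_j*` (4.4.4) commutes with the reflections**: `𝒟_k(c_ρA) = c_ρ(𝒟_kA)` — term by term from `HkE_vecReflE`,
its adjoint (`adjoint_intertwine`) and `CE_vecReflE`; `k ≤ m + K`, `c ≠ 0`, `w > 0`. [cite: BalabanImbrieJaffe1985, (4.4.4) p.312] -/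
theorem DkE_vecReflE (ρ : Fin P.d) : ∀ {k : ℕ} (_ : k ≤ P.m + P.K) {c : ℝ} (_ : c ≠ 0) {w : ℝ} (_ : 0 < w) (A : BondSpace P),
    DkE P w c k (vecReflE ρ 0 A) = vecReflE ρ 0 (DkE P w c k A)
  | 0, _, c, _, w, _, A => by simp [DkE]
  | k + 1, hk, c, hc, w, hw, A => by
    have hk' : k ≤ P.m + P.K := by omega
    rw [DkE_succ, LinearMap.add_apply, LinearMap.add_apply, map_add, DkE_vecReflE ρ hk' hc hw A]
    simp only [LinearMap.comp_apply]
    rw [adjoint_intertwine (HkE P w c k) (vecReflE ρ k) (vecReflE ρ 0) (HkE_vecReflE hk' hc hw ρ) A, CE_vecReflE hk hc hw,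
      HkE_vecReflE hk' hc hw]

/-- `T_k` as a composite of the Euclidean operators of record: `T_kF = ι⁻¹(𝒟_k∂^*Q^{e*}_k(ι_kF))`. [cite: BalabanImbrieJaffe1988, (5.4.1) p.281] -/
theorem TkF_eq (hd : 2 ≤ P.d) (w η : ℝ) (k : ℕ) (F : TPlaq P k → ℝ) :
    TkF P hd w η k F = (toE P).symm (DkE P w η⁻¹ k (LinearMap.adjoint (curlOp (P := P) w η⁻¹) (QesOp (P := P) hd w k (toU P k F)))) :=
  rfl

/-- **`T_k = 𝒟_k∂^*Q^{e*}_k` COMMUTES WITH THE REFLECTIONS**: `T_k(c_ρg) = c_ρ(T_kg)` for p11's correction operator of the second form of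
(7.3.2) / [BalabanImbrieJaffe1988] (5.4.1) on plain functions (unit-lattice plaquette functions → η-bond functions), every torus,
`k ≤ m + K`, `w > 0`, `η > 0` — the composite of `QesOp_plaqReflE`, `adjoint_curlOp_plaqReflE`, `DkE_vecReflE`.
[cite: BalabanImbrieJaffe1985, (7.3.2) p.326] -/
theorem TkF_reflP (hd : 2 ≤ P.d) {k : ℕ} (hk : k ≤ P.m + P.K) {w : ℝ} (hw : 0 < w) {η : ℝ} (hη : 0 < η) (ρ : Fin P.d)
    (g : TPlaq P k → ℝ) : TkF P hd w η k (reflP ρ g) = reflV ρ (TkF P hd w η k g) := by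
  have hc : η⁻¹ ≠ 0 := inv_ne_zero hη.ne'
  rw [TkF_eq, TkF_eq, toU_reflP, QesOp_plaqReflE hd hk, adjoint_curlOp_plaqReflE, DkE_vecReflE ρ hk hc hw, toE_symm_vecReflE]

/-! ## §4  `T_k` commutes with the unit-lattice translations -/

/-- `toU (τ_tg) = τ_t(toU g)`. [cite: BalabanImbrieJaffe1985, Thm. 7.1.1 p.321] -/
theorem toU_translP {k : ℕ} (t : TSite P k) (g : TPlaq P k → ℝ) : toU P k (translP t g) = unitPlaqTransl k t (toU P k g) := by
  ext p
  rw [unitPlaqTransl_apply]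
  rfl

/-- **`T_k` COMMUTES WITH THE UNIT-LATTICE TRANSLATIONS**: `T_k(τ_tg) = τ_{L^kt}(T_kg)`, `t ∈ T^{(k)}` acting on `T^{(0)}` by
`Site.scaleTo k t` — r18's `DkE_translate`, g3's `QesOp_unitPlaqTransl`, `curlOp_bondTransl` (+ `adjoint_intertwine`); every torus,
`k ≤ m + K`, `w > 0`, `η > 0`.  ([BalabanImbrieJaffe1988] p. 260: *"H_k is also translation invariant"*.) [cite: BalabanImbrieJaffe1985, Thm. 7.1.1 p.321] -/
theorem TkF_translP (hd : 2 ≤ P.d) {k : ℕ} (hk : k ≤ P.m + P.K) {w : ℝ} (hw : 0 < w) {η : ℝ} (hη : 0 < η) (t : TSite P k)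
    (g : TPlaq P k → ℝ) : TkF P hd w η k (translP t g) = translV (Site.scaleTo k t) (TkF P hd w η k g) := by
  have hc : η⁻¹ ≠ 0 := inv_ne_zero hη.ne'
  rw [TkF_eq, TkF_eq, toU_translP, QesOp_unitPlaqTransl hd hk, adjoint_intertwine _ _ _ (curlOp_bondTransl w η⁻¹ (Site.scaleTo k t)),
    DkE_translate hk hc hw, toE_symm_bondTransl]

end

end Literature.MathematicalPhysics.QuantumFieldTheory.BalabanImbrieJaffe1984to88.BIJ85TkCovariance
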